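import Mathlib
import Summits.ResolutionOfSingularities.ResolutionOfSingularities.Theorems.HomologicalConductorPersistenceAdjoinInv
import Summits.ResolutionOfSingularities.ResolutionOfSingularities.Theorems.SyzygyFlatteningHigherRankTerminationNrmLocAt
import Summits.ResolutionOfSingularities.ResolutionOfSingularities.Theorems.HomologicalConductorPersistenceNrmAdjoinInv
import Summits.ResolutionOfSingularities.ResolutionOfSingularities.Theorems.HomologicalConductorPersistenceCoreReduction
import HarnessLib

/-!
# Crux `Persistence` (stmt-ResolutionOfSingularities-16484), line `birth` — the normalised
affine `ca`-chart is regular off the exceptional element (helpers for the core stub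
`stub_normalisedChartPersistence`)

Route `ResolutionOfSingularities/HomologicalConductor`. The one open stub of the registered line
`birth` (reshape 3) reads: for a `k`-subalgebra `B ⊆ K` (local, essentially of finite type,
`Frac B = K`) and `0 ≠ x ∈ ca B` (image in `K` of the Iyengar–Takahashi cohomology annihilator
`Literature.RingTheory.CohomologyAnnihilator.cohomologyAnnihilator ↥B`), the image of `ca B` lies
in the image of `ca C` for the NORMALISED affine blow-up chart
`C = nrm (B[ca B / x])`, `B[ca B/x] = k[B ∪ {c * x⁻¹ | c ∈ ca B}]`; equivalently `x ∈ ca C`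
(landed `PersistenceNormalisedChartRegular.stub_iff_mem`, p458744). This file lands the
"regular off the centre" package (R) of the chain plan `L/w44b/CHAIN.md` v0 §1:

* the chart and its normalisation become `B[x⁻¹]` after inverting `x`:
  `k[B[ca B/x] ∪ {x⁻¹}] = B[x⁻¹]` and `k[nrm (B[ca B/x]) ∪ {x⁻¹}] = B[x⁻¹]`
  (`adjoin_affChart_inv_eq`, `adjoin_nrm_affChart_inv_eq`: normalisation commutes with
  adjoining inverses — landed `stub_nrm_adjoin_inv` — and `B[x⁻¹]` is already normal,
  `PersistenceAdjoinInv.nrm_adjoin_inv_eq_self`);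
* hence **`Sing C ⊆ V(x)`**: for every prime `Q` of `C = nrm (B[ca B/x])` not containing `x`,
  `C_Q` is a localisation of the regular ring `B[x⁻¹]` and is a regular local ring
  (`isRegularLocalRing_localization_atPrime_of_not_mem`; membership form
  `mem_of_not_isRegularLocalRing`: a singular prime of `C` contains `x`); the same in the chain
  plan's binders over the route vocabulary `NoZeno.Birth.{ca, nrm}` (`regularOffCentre`, the
  hypothesis `hreg` of the radical statement H-c of `L/w44b/PlanSignatures.lean`).

What is NOT here: the content of the stub — the exponent ONE (`x ∈ ca C` itself) — and its
radical shadow `x ∈ √(ca C)` (given Iyengar–Takahashi Thm. 5.4), which the chain plan assigns to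
another helper file (`HomologicalConductorPersistenceRadical.lean`) importing this one.

References: S. B. Iyengar, R. Takahashi, *Annihilation of cohomology and strong generation of
module categories*, IMRN 2016, Lemma 2.10 [`IyengarTakahashi2014`].
-/

-- single-problem summit: the doubled namespace component is forced
set_option linter.dupNamespace false

noncomputable section

namespace Summit.ResolutionOfSingularities.ResolutionOfSingularities.Theorems.HomologicalConductor.PersistenceRegularOffCentre

open Literature.RingTheory.CohomologyAnnihilator
open Summit.ResolutionOfSingularities.ResolutionOfSingularities.Theorems.SyzygyFlattening
  (nrm self_le_nrm)
open Summit.ResolutionOfSingularities.ResolutionOfSingularities.Theorems.HomologicalConductor.PersistenceNrmAdjoinInv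
  (nrm_adjoin_union_inv)
open Summit.ResolutionOfSingularities.ResolutionOfSingularities.Theorems.HomologicalConductor.PersistenceAdjoinInv
  (setOf_inv_mem_singleton le_adjoin_inv inv_mem_adjoin_inv isNoetherianRing_adjoin_inv
    cohomologyAnnihilator_adjoin_inv_eq_top nrm_adjoin_inv_eq_self
    isRegularLocalRing_localization_atPrime_of_adjoin_inv)

variable {k K : Type} [Field k] [Field K] [Algebra k K]

/-! ## The affine chart and its normalisation after inverting `x` -/

/-- `k[B[ca B/x] ∪ {x⁻¹}] = B[x⁻¹]`: the chart generators `c * x⁻¹` (`c ∈ ca B ⊆ B`) already lie in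
`B[x⁻¹]`. [folklore] -/
theorem adjoin_affChart_inv_eq (B : Subalgebra k K) (x : K) :
    Algebra.adjoin k (((Algebra.adjoin k ((B : Set K) ∪
        {y : K | ∃ c ∈ ((↑) : ↥B → K) '' (cohomologyAnnihilator ↥B : Set ↥B), y = c * x⁻¹}) :
          Subalgebra k K) : Set K) ∪ {x⁻¹}) =
      Algebra.adjoin k ((B : Set K) ∪ {x⁻¹}) := by
  refine le_antisymm ?_ (Algebra.adjoin_mono (Set.union_subset_union_left _
    fun y hy => Algebra.subset_adjoin (Or.inl hy)))
  refine Algebra.adjoin_le ?_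
  rintro y (hy | hyx)
  · revert y
    change Algebra.adjoin k _ ≤ _
    refine Algebra.adjoin_le ?_
    rintro y (hy | ⟨c, ⟨c', -, rfl⟩, rfl⟩)
    · exact le_adjoin_inv B x hy
    · exact Subalgebra.mul_mem _ (le_adjoin_inv B x c'.2) (inv_mem_adjoin_inv B x)
  · rw [Set.mem_singleton_iff] at hyx
    rw [hyx]
    exact inv_mem_adjoin_inv B x

/-- **`k[nrm (B[ca B/x]) ∪ {x⁻¹}] = B[x⁻¹]`** (`B` noetherian, `Frac B = K`, `0 ≠ x ∈ ca B`):
normalisation commutes with adjoining inverses (landed `stub_nrm_adjoin_inv`), the chart becomes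
`B[x⁻¹]` after inverting `x`, and `B[x⁻¹]` is already normal. [folklore] -/
theorem adjoin_nrm_affChart_inv_eq (B : Subalgebra k K) {x : K}
    (hxca : x ∈ ((↑) : ↥B → K) '' (cohomologyAnnihilator ↥B : Set ↥B)) (hx0 : x ≠ 0)
    (hB : IsNoetherianRing ↥B) (hfrac : IsFractionRing ↥B K) :
    Algebra.adjoin k (((nrm (Algebra.adjoin k ((B : Set K) ∪
        {y : K | ∃ c ∈ ((↑) : ↥B → K) '' (cohomologyAnnihilator ↥B : Set ↥B), y = c * x⁻¹})) :
          Subalgebra k K) : Set K) ∪ {x⁻¹}) =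
      Algebra.adjoin k ((B : Set K) ∪ {x⁻¹}) := by
  have hxB : x ∈ B := by obtain ⟨x', -, rfl⟩ := hxca; exact x'.2
  set Aff : Subalgebra k K := Algebra.adjoin k ((B : Set K) ∪
    {y : K | ∃ c ∈ ((↑) : ↥B → K) '' (cohomologyAnnihilator ↥B : Set ↥B), y = c * x⁻¹}) with hAff
  have hT : ({x} : Set K) ⊆ ↑Aff := by
    rintro _ rfl
    exact Algebra.subset_adjoin (Or.inl hxB)
  have h1 := nrm_adjoin_union_inv Aff {x} hT
  rw [setOf_inv_mem_singleton] at h1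
  rw [← h1, hAff, adjoin_affChart_inv_eq B x]
  exact nrm_adjoin_inv_eq_self B hxca hx0 hB hfrac

/-- `x` lies in the normalised chart `nrm (B[ca B/x])` as soon as `x ∈ B`. [folklore] -/
theorem mem_nrm_affChart (B : Subalgebra k K) {x : K} (hxB : x ∈ B) :
    x ∈ nrm (Algebra.adjoin k ((B : Set K) ∪
      {y : K | ∃ c ∈ ((↑) : ↥B → K) '' (cohomologyAnnihilator ↥B : Set ↥B), y = c * x⁻¹})) :=
  self_le_nrm _ (Algebra.subset_adjoin (Or.inl hxB))

/-! ## `Sing (nrm (B[ca B/x])) ⊆ V(x)` -/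

/-- **The normalised affine `ca`-chart is regular off `V(x)`.** Let `B ⊆ K` be noetherian with
`Frac B = K` and `0 ≠ x ∈ ca B`, and let `C = nrm (B[ca B/x])`. For every prime `Q` of `C` with
`x ∉ Q`, the local ring `C_Q` is regular: `C[x⁻¹] = B[x⁻¹]` is noetherian with `ca = ⊤`
(`adjoin_nrm_affChart_inv_eq`, `cohomologyAnnihilator_adjoin_inv_eq_top`), and
`isRegularLocalRing_localization_atPrime_of_adjoin_inv` applies. In words: `Sing C ⊆ V(x)`.
[cite: IyengarTakahashi2014, Lemma 2.10] -/
theorem isRegularLocalRing_localization_atPrime_of_not_mem (B : Subalgebra k K) {x : K}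
    (hxca : x ∈ ((↑) : ↥B → K) '' (cohomologyAnnihilator ↥B : Set ↥B)) (hx0 : x ≠ 0)
    (hB : IsNoetherianRing ↥B) (hfrac : IsFractionRing ↥B K)
    (Q : Ideal ↥(nrm (Algebra.adjoin k ((B : Set K) ∪
      {y : K | ∃ c ∈ ((↑) : ↥B → K) '' (cohomologyAnnihilator ↥B : Set ↥B), y = c * x⁻¹}))))
    [Q.IsPrime]
    (hxQ : (⟨x, mem_nrm_affChart B (by obtain ⟨x', -, rfl⟩ := hxca; exact x'.2)⟩ : ↥(nrm
      (Algebra.adjoin k ((B : Set K) ∪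
        {y : K | ∃ c ∈ ((↑) : ↥B → K) '' (cohomologyAnnihilator ↥B : Set ↥B), y = c * x⁻¹}))))
      ∉ Q) :
    IsRegularLocalRing (Localization.AtPrime Q) := by
  have hxB : x ∈ B := by obtain ⟨x', -, rfl⟩ := hxca; exact x'.2
  have hLB := adjoin_nrm_affChart_inv_eq B hxca hx0 hB hfrac
  refine isRegularLocalRing_localization_atPrime_of_adjoin_inv _ (mem_nrm_affChart B hxB) hx0
    ?_ ?_ Q hxQ
  · rw [hLB]; exact isNoetherianRing_adjoin_inv B hxB hx0 hB
  · rw [hLB]; exact cohomologyAnnihilator_adjoin_inv_eq_top B hxca hx0 hB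

/-- **`Sing C ⊆ V(x)`, membership form** (contrapositive of
`isRegularLocalRing_localization_atPrime_of_not_mem`, the shape consumed together with
Iyengar–Takahashi Thm. 5.4 `ca C ⊆ Q ↔ C_Q singular`): for `B ⊆ K` noetherian with `Frac B = K`,
`0 ≠ x ∈ ca B` and `C = nrm (B[ca B/x])`, every prime `Q` of `C` at which `C` is singular contains
`x`. [cite: IyengarTakahashi2014, Lemma 2.10] -/
theorem mem_of_not_isRegularLocalRing (B : Subalgebra k K) {x : K}
    (hxca : x ∈ ((↑) : ↥B → K) '' (cohomologyAnnihilator ↥B : Set ↥B)) (hx0 : x ≠ 0)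
    (hB : IsNoetherianRing ↥B) (hfrac : IsFractionRing ↥B K)
    (Q : Ideal ↥(nrm (Algebra.adjoin k ((B : Set K) ∪
      {y : K | ∃ c ∈ ((↑) : ↥B → K) '' (cohomologyAnnihilator ↥B : Set ↥B), y = c * x⁻¹}))))
    [Q.IsPrime] (hQ : ¬ IsRegularLocalRing (Localization.AtPrime Q)) :
    (⟨x, mem_nrm_affChart B (by obtain ⟨x', -, rfl⟩ := hxca; exact x'.2)⟩ : ↥(nrm
      (Algebra.adjoin k ((B : Set K) ∪
        {y : K | ∃ c ∈ ((↑) : ↥B → K) '' (cohomologyAnnihilator ↥B : Set ↥B), y = c * x⁻¹}))))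
      ∈ Q := by
  by_contra hxQ
  exact hQ (isRegularLocalRing_localization_atPrime_of_not_mem B hxca hx0 hB hfrac Q hxQ)

/-! ## The same, in the chain plan's binders (`NoZeno.Birth.ca`, any name for the annihilator set) -/

/-- **Regular off `V(x)`, for the chart built on ANY set `S` equal to the image of `ca B`**
(so that both the skeleton's `caK` and the route's inline `NoZeno.Birth.ca` instantiate it): for
`B` essentially of finite type with `Frac B = K`, `0 ≠ x ∈ S`, and a prime `P` of
`nrm (k[B ∪ {c * x⁻¹ | c ∈ S}])` containing no lift of `x`, `P` is a regular point.
[cite: IyengarTakahashi2014, Lemma 2.10] -/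
theorem isRegularLocalRing_localization_atPrime_of_forall_ne (B : Subalgebra k K) (x : K)
    (hBft : Algebra.EssFiniteType k ↥B) (hBfrac : IsFractionRing ↥B K) (S : Set K)
    (hS : S = ((↑) : ↥B → K) '' (cohomologyAnnihilator ↥B : Set ↥B)) (hx : x ∈ S) (hx0 : x ≠ 0)
    (P : Ideal ↥(nrm (Algebra.adjoin k ((B : Set K) ∪ {y : K | ∃ c ∈ S, y = c * x⁻¹}))))
    [P.IsPrime]
    (hP : ∀ c : ↥(nrm (Algebra.adjoin k ((B : Set K) ∪ {y : K | ∃ c ∈ S, y = c * x⁻¹}))),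
      (c : K) = x → c ∉ P) :
    IsRegularLocalRing (Localization.AtPrime P) := by
  subst hS
  haveI := hBft
  exact isRegularLocalRing_localization_atPrime_of_not_mem B hx hx0
    (Algebra.EssFiniteType.isNoetherianRing k ↥B) hBfrac P (hP _ rfl)

/-- **(R)(c) in the chain plan's binders** (`L/w44b/PlanSignatures.lean`, `R_c_regularOffCentre`,
over `NoZeno.Birth.{ca, nrm}` and `affChart B x = k[B ∪ {c * x⁻¹ | c ∈ ca B}]`): for `B ⊆ K`
essentially of finite type with `Frac B = K` and `0 ≠ x ∈ ca B`, every prime of the normalised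
chart `nrm (affChart B x)` containing no lift of `x` has a regular localisation — the binder
`hreg` of the radical statement H-c, discharged. [cite: IyengarTakahashi2014, Lemma 2.10] -/
theorem regularOffCentre (B : Subalgebra k K) (x : K)
    (hBft : Algebra.EssFiniteType k ↥B) (hBfrac : IsFractionRing ↥B K)
    (hx : x ∈ NoZeno.Birth.ca B) (hx0 : x ≠ 0)
    (P : Ideal ↥(NoZeno.Birth.nrm (Algebra.adjoin k ((B : Set K) ∪
      {y : K | ∃ c ∈ NoZeno.Birth.ca B, y = c * x⁻¹})))) [P.IsPrime]
    (hP : ∀ c : ↥(NoZeno.Birth.nrm (Algebra.adjoin k ((B : Set K) ∪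
      {y : K | ∃ c ∈ NoZeno.Birth.ca B, y = c * x⁻¹}))), (c : K) = x → c ∉ P) :
    IsRegularLocalRing (Localization.AtPrime P) :=
  -- `NoZeno.Birth.nrm` is `SyzygyFlattening.nrm` by `rfl` (`NoZeno.Birth.nrm_eq_nrm`); the prime
  -- instance is handed over explicitly because instance search does not unfold `nrm`
  @isRegularLocalRing_localization_atPrime_of_forall_ne k K _ _ _ B x hBft hBfrac
    (NoZeno.Birth.ca B) (PersistenceCoreReduction.ca_eq_image B) hx hx0 P ‹P.IsPrime› hP

end Summit.ResolutionOfSingularities.ResolutionOfSingularities.Theorems.HomologicalConductor.PersistenceRegularOffCentre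

end
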